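import Mathlib
import Literature.MathematicalPhysics.QuantumFieldTheory.OSData

/-!
# Sketch (crux-ideate, stmt-QuantumFields-15828, ideator 1, round 1) — card `duality-selection-nlo-skewness`

First lemmas of the line "IsNonGaussian of the CLAY species (action density = sum over the six
planes) is an order-g² ultraviolet effect: the free field-strength propagator is bipartite between
self-dual and anti-self-dual two-forms, so the full six-plane triangle vanishes identically while a
single-orientation triangle does not".

* `hessInvSq`, `curvProp` — the free Euclidean Maxwell curvature two-point tensor
  `⟨F_{μν}(x) F_{ρσ}(0)⟩ ∝ -(δ_{νσ}∂_μ∂_ρ - δ_{νρ}∂_μ∂_σ - δ_{μσ}∂_ν∂_ρ + δ_{μρ}∂_ν∂_σ)(1/|x|²)` as a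
  `6 × 6` real matrix on the ordered pairs `01,02,03,12,13,23` (overall positive constant dropped).
* `hodge` — the Hodge star on two-forms in these coordinates.
* `HodgeAnticommutes`, `SelfDualBlockVanishes`, `OddCyclesVanish` — the selection rule and its
  consequence (all provable now: `Δ(1/|x|²) = 0` off the origin makes `∂∂(1/|x|²)` traceless, and a
  traceless symmetric `H` induces a two-form operator anticommuting with `⋆`).
* `SkewnessLimitAlong`, `FirstLemma` — the crux-facing interface: a normalised sequence of
  off-diagonal third cumulants of ONE species converging to a non-zero number witnesses
  `OSData.IsNonGaussian` (pure logic; what the UV engine must deliver is the convergence).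
-/

noncomputable section

namespace Summit.QuantumFields.YangMills.Cruxes.ContinuumLegGivenGap.DualitySelection

open scoped SchwartzMap
open Filter Topology
open Literature.MathematicalPhysics.AQFT Literature.MathematicalPhysics.QuantumLattice
open Literature.MathematicalPhysics.QuantumFieldTheory

/-- Hessian of `x ↦ 1/|x|²` on `ℝ⁴` (up to the factor `1/(4π²)`):
`∂_μ∂_ν |x|⁻² = -2 δ_{μν} |x|⁻⁴ + 8 x_μ x_ν |x|⁻⁶`. [folklore] -/
def hessInvSq (x : EuclideanSpace ℝ (Fin 4)) : Matrix (Fin 4) (Fin 4) ℝ :=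
  fun μ ν => -2 * (if μ = ν then (1 : ℝ) else 0) / ‖x‖ ^ 4 + 8 * x μ * x ν / ‖x‖ ^ 6

/-- The six ordered index pairs `01, 02, 03, 12, 13, 23` labelling independent two-form components. [folklore] -/
def pairTab : Fin 6 → Fin 4 × Fin 4 := ![(0, 1), (0, 2), (0, 3), (1, 2), (1, 3), (2, 3)]

/-- Kronecker delta on `Fin 4`. [folklore] -/
def kron (a b : Fin 4) : ℝ := if a = b then 1 else 0

/-- Free Euclidean Maxwell curvature propagator `⟨F_A(x) F_B(0)⟩`, `A, B` two-form labels, Feynman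
gauge, positive normalisation constant dropped (sign convention: positive at displacements
perpendicular to both planes, `-1/(π² n⁴)` in-plane, matching the tree's `G_M`). [folklore] -/
def curvProp (x : EuclideanSpace ℝ (Fin 4)) : Matrix (Fin 6) (Fin 6) ℝ :=
  fun A B =>
    -(kron (pairTab A).2 (pairTab B).2 * hessInvSq x (pairTab A).1 (pairTab B).1
      - kron (pairTab A).2 (pairTab B).1 * hessInvSq x (pairTab A).1 (pairTab B).2
      - kron (pairTab A).1 (pairTab B).2 * hessInvSq x (pairTab A).2 (pairTab B).1
      + kron (pairTab A).1 (pairTab B).1 * hessInvSq x (pairTab A).2 (pairTab B).2)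

/-- The Hodge star on two-forms of `ℝ⁴` in the basis `pairTab`: `(⋆F)₀₁ = F₂₃`, `(⋆F)₀₂ = -F₁₃`,
`(⋆F)₀₃ = F₁₂` and symmetrically. [folklore] -/
def hodge : Matrix (Fin 6) (Fin 6) ℝ :=
  !![0, 0, 0, 0, 0, 1;
     0, 0, 0, 0, -1, 0;
     0, 0, 0, 1, 0, 0;
     0, 0, 1, 0, 0, 0;
     0, -1, 0, 0, 0, 0;
     1, 0, 0, 0, 0, 0]

/-- **Selection rule, operator form**: off the origin the free curvature propagator ANTICOMMUTES
with the Hodge star (it maps self-dual to anti-self-dual two-forms), because `∂∂(1/|x|²)` is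
traceless. [folklore] -/
def HodgeAnticommutes : Prop :=
  ∀ x : EuclideanSpace ℝ (Fin 4), x ≠ 0 → hodge * curvProp x = -(curvProp x * hodge)

/-- **Selection rule, block form**: the self-dual/self-dual block `Π⁺ G(x) Π⁺` vanishes for `x ≠ 0`
(`Π⁺ = (1 + ⋆)/2`; a pure contact term in the distributional sense). [folklore] -/
def SelfDualBlockVanishes : Prop :=
  ∀ x : EuclideanSpace ℝ (Fin 4), x ≠ 0 →
    ((1 : Matrix (Fin 6) (Fin 6) ℝ) + hodge) * curvProp x * ((1 : Matrix (Fin 6) (Fin 6) ℝ) + hodge) = 0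

/-- **Odd Wick cycles vanish**: for pairwise distinct points the triangle of free curvature
propagators has zero trace — hence the tree-level (order `g⁶`) connected three-point function of
the FULL action density `Σ_{μ<ν} F_{μν}F_{μν}` of free glue vanishes at non-coincident points,
whereas a single-orientation triangle (e.g. all three plaquettes in the `01` plane at mutually
perpendicular displacements) does not. [folklore] -/
def OddCyclesVanish : Prop :=
  ∀ x y z : EuclideanSpace ℝ (Fin 4), x ≠ y → y ≠ z → z ≠ x →
    Matrix.trace (curvProp (x - y) * curvProp (y - z) * curvProp (z - x)) = 0

variable {ι : Type}

/-- The connected three-point combination of `OSData.IsNonGaussian`, for one species `s` and one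
admissible family of tensors. [folklore] -/
def cumulant3 (T : OSData ι 4) (s : ι) (Ffgh : 𝓢((Fin 3 → EuclideanSpace ℝ (Fin 4)), ℂ))
    (Fgh Ffh Ffg : 𝓢((Fin 2 → EuclideanSpace ℝ (Fin 4)), ℂ))
    (Ff Fg Fh : 𝓢((Fin 1 → EuclideanSpace ℝ (Fin 4)), ℂ)) : ℂ :=
  let S : (n : ℕ) → 𝓢((Fin n → EuclideanSpace ℝ (Fin 4)), ℂ) → ℂ := fun n F => T.schwinger n (fun _ => s) F
  S 3 Ffgh - S 1 Ff * S 2 Fgh - S 1 Fg * S 2 Ffh - S 1 Fh * S 2 Ffg + 2 * (S 1 Ff * S 1 Fg * S 1 Fh)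

/-- **Crux-facing interface (what a UV engine must deliver for the Clay species)**: along SOME
sequence of admissible off-diagonal tensors (in the line: dilates by `ε_j → 0` of one fixed
perpendicular triangle configuration) the third cumulant of species `s`, divided by positive weights
`w_j` (in the line: `g²(ε_j) ε_j⁻¹²` after the species normalisation), converges to a NON-ZERO
complex number (in the line: the universal order-`g²` coefficient `s₃` of the configuration). [folklore] -/
def SkewnessLimitAlong (T : OSData ι 4) (s : ι) : Prop :=
  ∃ (f g h : ℕ → 𝓢(EuclideanSpace ℝ (Fin 4), ℂ))
    (Ffgh : ℕ → 𝓢((Fin 3 → EuclideanSpace ℝ (Fin 4)), ℂ))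
    (Fgh Ffh Ffg : ℕ → 𝓢((Fin 2 → EuclideanSpace ℝ (Fin 4)), ℂ))
    (Ff Fg Fh : ℕ → 𝓢((Fin 1 → EuclideanSpace ℝ (Fin 4)), ℂ))
    (w : ℕ → ℝ) (s₃ : ℂ),
    s₃ ≠ 0 ∧ (∀ j, 0 < w j) ∧
    (∀ j, IsTensorOf (Ffgh j) ![f j, g j, h j] ∧ IsOffDiagonal (Ffgh j) ∧
      IsTensorOf (Fgh j) ![g j, h j] ∧ IsTensorOf (Ffh j) ![f j, h j] ∧ IsTensorOf (Ffg j) ![f j, g j] ∧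
      IsTensorOf (Ff j) ![f j] ∧ IsTensorOf (Fg j) ![g j] ∧ IsTensorOf (Fh j) ![h j]) ∧
    Tendsto (fun j => cumulant3 T s (Ffgh j) (Fgh j) (Ffh j) (Ffg j) (Ff j) (Fg j) (Fh j) / (w j : ℂ))
      atTop (𝓝 s₃)

/-- **First lemma of the line (pure logic, to be proved first)**: a non-zero normalised skewness
limit along admissible tensors witnesses `OSData.IsNonGaussian` — some term of a sequence converging
to a non-zero number is non-zero, and that term's tensors are the required witness. [folklore] -/
def FirstLemma : Prop :=
  ∀ (T : OSData ι 4) (s : ι), SkewnessLimitAlong T s → T.IsNonGaussian s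

end Summit.QuantumFields.YangMills.Cruxes.ContinuumLegGivenGap.DualitySelection

end
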